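import Mathlib.RingTheory.Flat.Localization
import Mathlib.RingTheory.Localization.FractionRing
import Mathlib.LinearAlgebra.TensorProduct.RightExactness
import Mathlib.LinearAlgebra.FiniteDimensional.Lemmas
import Mathlib.RingTheory.Flat.Basic
import HarnessLib

/-!
# λ-bookkeeping in exact sequences: `λ(B) + λ(D) = λ(A) + λ(C)` for `0 → A → B → C → D → 0`,
# `λ = dim_K(K ⊗_R ·)` over a domain `R` with fraction field `K` — the (f4) algebra of crux (R≥)ᵖ

Route `ResidualThetaTransportAtTwo` (RTT), crux (R≥)ᵖ `ResidualThetaCountLowerPureAtTwo`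
(stmt-BirchSwinnertonDyer-26074); seat `prover-bsd-wall-rtt-p2` g11 (`--supports`, closes nothing).
HONEST FRAMING: THEOREMS ONLY (no definition, no named fact, no instance, no `sorry`); pure linear
algebra (in fact `R` may be any commutative ring with a field of fractions `K`, `IsFractionRing R K`);
BSD is not proved by any of this.

WHY (memo `Cruxes/ResidualThetaCountLowerPureAtTwo/LINE-DESIGN-g11.md` §2 (f4)). On the CM side the port
of Kobayashi's four-term sequence `0 → 𝐇¹_Iw/Z → Λ_𝒪/(L⁻_g) → X⁺_g → 𝐇²_Iw → 0` together with the
cited `⊗ℚ` main conjecture (Burungale–Tian 2026, Thm. 2.6: `λ(𝐇¹_Iw/Z) = λ(𝐇²_Iw)`) must yield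
`λ_𝒪(X⁺_g) = λ_𝒪(Λ_𝒪/(L⁻_g))` (`= d`, file `…LambdaLowerBoundOWeierstrass`). In the λ-currency
`λ_𝒪(M) = dim_E(E ⊗_𝒪 M)` of the companion files this is the statement that `E ⊗_𝒪 ·` is exact
(`E = Frac 𝒪` is flat) plus rank–nullity, proved here for any domain `R` with fraction field `K`:

* `finrank_baseChange_add_eq_of_exact` — for `R`-linear `f : A → B`, `g : B → C`, `h : C → D` with `f`
  injective, `(f, g)` and `(g, h)` exact and `h` surjective, and `K ⊗ B`, `K ⊗ C` finite-dimensional: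
  `dim(K ⊗ B) + dim(K ⊗ D) = dim(K ⊗ A) + dim(K ⊗ C)`;
* `finrank_baseChange_eq_of_exact_of_eq` — hence `dim(K ⊗ A) = dim(K ⊗ D) → dim(K ⊗ B) = dim(K ⊗ C)`;
* `finrank_baseChange_eq_of_exact_three` — the short exact case `0 → A → B → C → 0`:
  `dim(K ⊗ B) = dim(K ⊗ A) + dim(K ⊗ C)`.

References: [Washington1997] §13.2 (λ is additive); [Kobayashi2003] Thm. 7.3 (the four-term sequence).
-/

set_option autoImplicit false
-- the Theorems namespace of this sub repeats the summit name by design (D-0017 nested layout)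
set_option linter.dupNamespace false

noncomputable section

open scoped TensorProduct

namespace Summit.BirchSwinnertonDyer.BirchSwinnertonDyer.Theorems.LambdaLowerBoundO

universe u v w

variable {R : Type u} [CommRing R] (K : Type v) [Field K] [Algebra R K] [IsFractionRing R K]
variable {A B C D : Type w} [AddCommGroup A] [Module R A] [AddCommGroup B] [Module R B]
  [AddCommGroup C] [Module R C] [AddCommGroup D] [Module R D]

/-- **Rank–nullity across a four-term exact sequence after the flat base change `K ⊗_R ·`:**
`dim(K ⊗ B) + dim(K ⊗ D) = dim(K ⊗ A) + dim(K ⊗ C)` for `0 → A → B → C → D → 0` exact.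
[cite: Washington1997, §13.2] -/
theorem finrank_baseChange_add_eq_of_exact (f : A →ₗ[R] B) (g : B →ₗ[R] C) (h : C →ₗ[R] D)
    (hf : Function.Injective f) (hfg : Function.Exact f g) (hgh : Function.Exact g h)
    (hh : Function.Surjective h)
    [FiniteDimensional K (K ⊗[R] B)] [FiniteDimensional K (K ⊗[R] C)] :
    Module.finrank K (K ⊗[R] B) + Module.finrank K (K ⊗[R] D) =
      Module.finrank K (K ⊗[R] A) + Module.finrank K (K ⊗[R] C) := by
  haveI : Module.Flat R K := IsLocalization.flat K (nonZeroDivisors R)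
  -- base-changed maps
  set f' := f.baseChange K with hf'
  set g' := g.baseChange K with hg'
  set h' := h.baseChange K with hh'
  have hf'inj : Function.Injective f' := by
    rw [hf', LinearMap.baseChange_eq_ltensor]
    exact Module.Flat.lTensor_preserves_injective_linearMap f hf
  have hfg' : Function.Exact f' g' := by
    rw [hf', hg', LinearMap.baseChange_eq_ltensor, LinearMap.baseChange_eq_ltensor]
    exact Module.Flat.lTensor_exact K hfg
  have hgh' : Function.Exact g' h' := by
    rw [hg', hh', LinearMap.baseChange_eq_ltensor, LinearMap.baseChange_eq_ltensor]
    exact Module.Flat.lTensor_exact K hgh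
  have hh'surj : Function.Surjective h' := by
    rw [hh', LinearMap.baseChange_eq_ltensor]
    exact LinearMap.lTensor_surjective K hh
  -- `K ⊗ A ≅ range f' = ker g'`, finite-dimensional
  have hA : Module.finrank K (K ⊗[R] A) = Module.finrank K (LinearMap.ker g') := by
    rw [LinearMap.exact_iff.mp hfg']
    exact (LinearEquiv.ofInjective f' hf'inj).finrank_eq
  -- `K ⊗ D ≅ (K ⊗ C) / range g' `
  have hD : Module.finrank K (K ⊗[R] D) + Module.finrank K (LinearMap.range g') =
      Module.finrank K (K ⊗[R] C) := by
    have h1 := LinearMap.finrank_range_add_finrank_ker h'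
    rw [LinearMap.range_eq_top.mpr hh'surj, finrank_top, LinearMap.exact_iff.mp hgh'] at h1
    rw [← h1]
  have hB := LinearMap.finrank_range_add_finrank_ker g'
  omega

/-- **If the outer terms of `0 → A → B → C → D → 0` have the same λ then so do the inner terms**:
`dim(K ⊗ A) = dim(K ⊗ D) → dim(K ⊗ B) = dim(K ⊗ C)` — the step «BT26 `⊗ℚ` + four-term sequence ⇒
`λ_𝒪(X⁺_g) = λ_𝒪(Λ_𝒪/(L⁻_g))`». [cite: Washington1997, §13.2] -/
theorem finrank_baseChange_eq_of_exact_of_eq (f : A →ₗ[R] B) (g : B →ₗ[R] C) (h : C →ₗ[R] D)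
    (hf : Function.Injective f) (hfg : Function.Exact f g) (hgh : Function.Exact g h)
    (hh : Function.Surjective h)
    [FiniteDimensional K (K ⊗[R] B)] [FiniteDimensional K (K ⊗[R] C)]
    (hAD : Module.finrank K (K ⊗[R] A) = Module.finrank K (K ⊗[R] D)) :
    Module.finrank K (K ⊗[R] B) = Module.finrank K (K ⊗[R] C) := by
  have := finrank_baseChange_add_eq_of_exact K f g h hf hfg hgh hh
  omega

omit [AddCommGroup D] [Module R D] in
/-- **Short exact case**: `dim(K ⊗ B) = dim(K ⊗ A) + dim(K ⊗ C)` for `0 → A → B → C → 0`.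
[cite: Washington1997, §13.2] -/
theorem finrank_baseChange_eq_of_exact_three (f : A →ₗ[R] B) (g : B →ₗ[R] C)
    (hf : Function.Injective f) (hfg : Function.Exact f g) (hg : Function.Surjective g)
    [FiniteDimensional K (K ⊗[R] B)] :
    Module.finrank K (K ⊗[R] B) = Module.finrank K (K ⊗[R] A) + Module.finrank K (K ⊗[R] C) := by
  haveI : Module.Flat R K := IsLocalization.flat K (nonZeroDivisors R)
  set f' := f.baseChange K with hf'
  set g' := g.baseChange K with hg'
  have hf'inj : Function.Injective f' := by
    rw [hf', LinearMap.baseChange_eq_ltensor]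
    exact Module.Flat.lTensor_preserves_injective_linearMap f hf
  have hfg' : Function.Exact f' g' := by
    rw [hf', hg', LinearMap.baseChange_eq_ltensor, LinearMap.baseChange_eq_ltensor]
    exact Module.Flat.lTensor_exact K hfg
  have hg'surj : Function.Surjective g' := by
    rw [hg', LinearMap.baseChange_eq_ltensor]
    exact LinearMap.lTensor_surjective K hg
  have hA : Module.finrank K (K ⊗[R] A) = Module.finrank K (LinearMap.ker g') := by
    rw [LinearMap.exact_iff.mp hfg']
    exact (LinearEquiv.ofInjective f' hf'inj).finrank_eq
  have hB := LinearMap.finrank_range_add_finrank_ker g'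
  rw [LinearMap.range_eq_top.mpr hg'surj, finrank_top] at hB
  omega

end Summit.BirchSwinnertonDyer.BirchSwinnertonDyer.Theorems.LambdaLowerBoundO

end
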